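import Literature.IUT.HodgeArakelov.GoodPrimeKummerBridgeSemiSimplified
import Literature.IUT.HodgeArakelov.GoodPrimeKummerBridgeTheta
import Literature.IUT.HodgeArakelov.GoodPrimeKummerBridgeArchSemiSimplified
import HarnessLib

/-!
# [IUTchIII] Proposition 2.1 (iv), (v): the unit portions of the Kummer isomorphisms at good nonarchimedean /
# archimedean primes ARE the labelled [IUTchII] Prop 4.2 (i)(ii) / Prop 4.4 (i)(ii) isomorphisms — proof-only

Mochizuki, *Inter-universal Teichmüller Theory III*, kurims manuscript (May 2020), §2, Proposition 2.1 (iv), (v),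
p. 60, read on the page (lit key `paper:url-4b091feeb646`, p. 60); [IUTchII] (Dec 2020) Prop 4.2 (i)(ii) p. 124,
Prop 4.4 (i)(ii) pp. 129–130 (`paper:url-5036b4059555`). [claim: Mochizuki2012, status: disputed] (D-0012 claim
key). Printed proof (III p. 61): "The various assertions of Proposition 2.1 follow immediately from the
definitions and the references quoted in the statements of these assertions." abc-iut cell, DAG nodes
IUTchIII:Prop2.1(iv) / IUTchIII:Prop2.1(v); SUBDAG `plan/L6/SUBDAG-IUTchIII-Prop-21.md` rows r16 («Prop21_iv») and
r21 («Prop21_v»), the two UNTYPED INTERMEDIATES of that sub-DAG; L6-lead §F v1.19h GO (a). PROOF-ONLY (no `def`,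
no new `Prop`): every theorem is a junction between the printed clause and abc-iut-L6-t5's F9 theorems
(`GoodPrimeKummer.prop42i_of_monoAnalytic`, `prop42iiUnit_of_monoAnalytic`, `semiSimplifiedPolyIsoNonarch`,
`Prop44i_holds`, `unitKummerTopIso_orbit`, `semiSimplifiedPolyIso`, p415949/p415883/p416766/p418015/p418683/
p419040/p419921) consumed BY NAME.

PRINTED TEXT (III p. 60). (iv) "(Kummer Theory at Good Nonarchimedean Primes) The unit portion at
`v ∈ V^good ∩ V^non` of the Kummer isomorphisms of (ii) is obtained [cf. [IUTchII], Proposition 4.2, (iv)] as the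
unit portion of a “labeled version” of the isomorphism of ind-topological monoids equipped with a topological group
action — i.e., in the language of [AbsTopIII], Definition 3.1, (ii), the isomorphism of “MLF-Galois TM-pairs” —
discussed in [IUTchII], Proposition 4.2, (i) [cf. also [IUTchII], Remark 1.11.1, (i), (a); [AbsTopIII], Proposition
3.2, (iv)]. In particular, the portion at `v ∈ V^good ∩ V^non` of the `Aut_{F^⊩}(†F^⊩_env)`-orbit of the second
isomorphism of the final display of (ii) may be obtained as a “labeled version” of the “Kummer poly-isomorphism of
semi-simplifications” given in the final display of [IUTchII], Proposition 4.2, (ii)." (v) "(Kummer Theory at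
Archimedean Primes) The unit portion at `v ∈ V^arc` of the Kummer isomorphisms of (ii) is obtained [cf. [IUTchII],
Proposition 4.4, (iv)] as the unit portion of a “labeled version” of the isomorphism of topological monoids
discussed in [IUTchII], Proposition 4.4, (i). In particular, the portion at `v ∈ V^arc` of the
`Aut_{F^⊩}(†F^⊩_env)`-orbit of the second isomorphism of the final display of (ii) may be obtained as a “labeled
version” of the “Kummer poly-isomorphism of semi-simplifications” given in the final display of [IUTchII],
Proposition 4.4, (ii) [cf. also [IUTchII], Remark 4.6.1]."

WHERE THE STATEMENT LIVES. abc-iut-L6-t3's frame-level interface `Literature.IUT.LogThetaLattice.ThetaMonoidData`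
(ThetaMonoids.lean p405523; real frame `StripFrame.ofKits` / `ThetaMonoidData.ofKits`, ThetaMonoidsOfKits.lean
p418963) records the Kummer isomorphisms of Prop 2.1 (ii) as NATURAL ISOMORPHISMS `kummerΨ`, `kummerFgl`, …
valued in an abstract category `TM` of "collections of data indexed by `V̲`": it has no `v`-components and no
unit portions, so the frame-level content of (iv)/(v) is exhausted by abc-iut-w4-d022's
`ThetaMonoidData.autOrbit_kummerFglAt_eq_full` / `autOrbit_kummerFgl_fxm_eq_full` and
`PointedHalfLine.addEquiv_eq_of_apply_pt` (ThetaMonoidsProofs2.lean p412163), which left the EXISTENCE of the unit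
portions as the then-empty slots `Prop42Statements` / `Prop44Statements`. Those slots are now REAL and PROVED
(F9). (iv)/(v) are statements about the `v`-COMPONENTS at `v ∈ V^good ∩ V^non` / `v ∈ V^arc`, indexed by the
labels `t ∈ LabCusp^±`; they are typed here where that content lives — over abc-iut-L4-t2's [AbsTopIII] Def 3.1
pairs `GaloisMonoidPair` (`(G_v(†Π_v) ↷ Ψ_{†F_v})_t`, `(G_v(†Π_v) ↷ Ψ_cns(†Π_v))_t`) and abc-iut-L5-t2's [IUTchI]
Ex 3.4 archimedean Frobenioids `ArchLocalFrobenioid` — for ANY labelled family of `G_v`-equivariant Kummer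
isomorphisms, in particular the `(v, t)`-components of (ii) in any instantiation of `TM` by `V̲`-indexed
collections (MERGE-MAP row «`ThetaMonoidData` TM/RF := t2's Cor 4.5/4.6 collections», owners abc-iut-L6-t2/t1;
no carrier is introduced here).

WHAT THE KERNEL IS MADE TO SAY. (iv), `v ∈ V^good ∩ V^non`, labels `t : Lab`, families `P Q : Lab → GaloisMonoidPair`
of `TM`-pairs OF MONO-ANALYTIC TYPE with identifications `f t` of the acting groups:
* `prop21iv_labeled_existsUnique` — the "labeled version of the isomorphism of MLF-Galois TM-pairs of Prop 4.2
  (i)" EXISTS AND IS UNIQUE as a family (`∃! Φ, ∀ t, Φ t` is `f t`-equivariant), unconditionally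
  (`prop42i_of_monoAnalytic` label by label + function extensionality);
* `prop21iv_kummer_eq` — "is obtained as": ANY labelled family of `f t`-equivariant isomorphisms (the
  `(v, t)`-components of a Kummer isomorphism of (ii)) coincides with any other, hence with the labelled Prop 4.2
  (i) family; `prop21iv_piCongrRight_eq_labeledIso` — on literal copies (abc-iut-L6-t2's convention) the
  family, as one isomorphism of product monoids, IS F9's `labeledIso Lab φ` ([IUTchII] Prop 4.2 (iii));
* `unitsMapEquiv_mem_equivariantIsoOver`, `isOfMonoAnalyticTypeMonoid_TCG_unitsPair` — the UNIT PORTION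
  `φ^× := Units.mapEquiv φ` of an equivariant isomorphism is an equivariant isomorphism of the unit pairs
  `(Π ↷ M^×)` ([AbsTopIII] Def 3.1 (iii), abc-iut-L4-t2's `unitsPair`), and the unit pair of a `TM`-pair of
  mono-analytic type is a `TCG`-pair of mono-analytic type;
* `prop21iv_unitPortion` — "the unit portion … is obtained as the unit portion of [the Prop 4.2 (i)
  isomorphism]": the unit portion of the `(v,t)`-Kummer isomorphism is THE member of the unique `Ẑ^×`-torsor of
  Prop 4.2 (ii) (`Prop42iiUnit`, which HOLDS for these unit pairs: `prop21iv_prop42iiUnit`) singled out by its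
  own cyclotome datum, and on the theta monoids the F9 Kummer isomorphism `Ψ_{†F^Θ_v} ⥲ Ψ_env(†Π_v)` built on it
  restricts to it on units (`prop21iv_thetaKummerIso_unit`, [IUTchII] Prop 4.2 (iv));
* `prop21iv_autOrbit_eq_semiSimplifiedPolyIso` — "In particular": the orbit of the member
  `φ^× × ρ₀ : Ψ^ss_{†F^⊢_v} ⥲ Ψ^ss_cns(†G_v)` under the automorphisms `α × id` of `Ψ^ss_{†F^⊢_v} = Ψ^× × Ψ^R` (`α` a
  `G_v`-equivariant automorphism of the unit pair — the unit-portion action of `Aut_{F^⊩}(†F^⊩_env)` at `v`; the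
  realified portion is rigid, w4-d022's `PointedHalfLine.addEquiv_eq_refl_of_apply_pt`) is EXACTLY F9's "Kummer
  poly-isomorphism of semi-simplifications" `semiSimplifiedPolyIsoNonarch` ([IUTchII] Prop 4.2 (ii) final
  display), label by label; `prop21iv_semiSimplifiedPolyIso_torsor` — and that poly-isomorphism is exactly one
  `Ẑ^×`-torsor, now unconditionally (F9's `existsUnique_mem_semiSimplifiedPolyIsoNonarch` with its two
  mono-analytic-unit-pair hypotheses discharged by `isOfMonoAnalyticTypeMonoid_TCG_unitsPair`).
(v), `v ∈ V^arc`, an instance `X` of the [IUTchI] Ex 3.4 interface and labels `t : Lab`: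
* `prop21v_labeled_eq_const` / `prop21v_piCongrRight_eq_archLabeledIso` — every labelled family of isomorphisms
  `Ψ_{†F_v} ⥲ Ψ_cns(†U_v)` through which the Kummer structure `†κ_v` factors is the constant family of F9's
  `kummerIsoArch X` (Prop 4.4 (i) uniqueness `eq_kummerIsoArch`), i.e. `archLabeledIso X Lab` on products;
* `prop21v_unitPortion` — its unit portion is `φ^× = unitKummerTopIso X` (as a group isomorphism), a member of
  the unique `{±1}`-orbit of Prop 4.4 (ii) (`Prop44iiUnit_holds`, `unitKummerTopIso_orbit` BY NAME);
* `prop21v_autOrbit_eq_semiSimplifiedPolyIso` — "In particular": the orbit of `φ^× × ρ` under `ε × id`, `ε`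
  ranging over ALL automorphisms of the topological group `Ψ^×_{†F^⊢_v}`, is EXACTLY F9's poly-isomorphism
  `semiSimplifiedPolyIso X` (Prop 4.4 (ii) final display) — i.e. `{φ^× × ρ, (φ^× ∘ (−)⁻¹) × ρ}`.

HONEST FRAMING. Junction-level algebra over the cell's own [AbsTopIII]/[IUTchI]/[IUTchII] vocabulary; the
anabelian input ([IUTchII] Rmk 1.11.1 (i)(a)(b) = [AbsAnab] Prop 1.2.1 (vii) transport) enters only through
F9's already-unconditional theorems; nothing here bears on the disputed [IUTchIII] Cor. 3.12 or takes a side;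
typed ≠ discharged elsewhere.
-/

noncomputable section

open scoped NNReal

namespace Literature.IUT.LogThetaLattice

open Literature.AnabelianGeometry.AbsoluteAnabelian
open Literature.AlgebraicGeometry.Frobenioids
open Literature.IUT.HodgeTheaters
open Literature.IUT.HodgeArakelov
open Literature.IUT.HodgeArakelov.GoodPrimeKummer

universe u w

/-! ### 0. A bookkeeping lemma on `f`-equivariant isomorphisms ([IUTchII] Prop 4.2 (i) vocabulary) -/

section Equivariant

variable {P Q : GaloisMonoidPair.{u}}

/-- **IUTchIII:Prop2.1(iv)** (kurims p.60) "the unit portion … of the isomorphism of MLF-Galois TM-pairs":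
the unit portion `φ^× = Units.mapEquiv φ : M^× ⥲ M*^×` of an `f`-equivariant isomorphism of monoids `φ : M ⥲ M*`
is an `f`-equivariant isomorphism of the unit pairs `(Π ↷ M^×)`, `(Π* ↷ M*^×)` ([AbsTopIII] Def 3.1 (iii),
abc-iut-L4-t2's `GaloisMonoidPair.unitsPair`, `GaloisMonoidPair.Iso.units`).
[claim: Mochizuki2012, status: disputed] -/
theorem unitsMapEquiv_mem_equivariantIsoOver {f : P.Pi ≃ₜ* Q.Pi} {φ : P.M ≃* Q.M}
    (hφ : φ ∈ equivariantIsoOver P Q f) :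
    Units.mapEquiv φ ∈ equivariantIsoOver P.unitsPair Q.unitsPair f :=
  isoM_mem_equivariantIsoOver (isoOfEquivariant f φ hφ).units

end Equivariant

/-! ### 1. (iv) at `v ∈ V^good ∩ V^non`: the labelled isomorphism of MLF-Galois `TM`-pairs -/

section GoodNonarch

variable {Lab : Type w} (P Q : Lab → GaloisMonoidPair.{0}) (f : ∀ t, (P t).Pi ≃ₜ* (Q t).Pi)

/-- **IUTchIII:Prop2.1(iv)** (kurims p.60) "a “labeled version” of the isomorphism … of “MLF-Galois TM-pairs”
… discussed in [IUTchII], Proposition 4.2, (i)": for families `t ↦ (G_v(†Π_v) ↷ Ψ_{†F_v})_t`, `t ↦ (G_v(†Π_v) ↷ Ψ_cns(†Π_v))_t`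
of `TM`-pairs of mono-analytic type indexed by the labels `t ∈ LabCusp^±(†Π_v)` and identifications `f t` of the
acting groups, there is EXACTLY ONE family `Φ` of `f t`-equivariant isomorphisms of monoids — the labelled Prop
4.2 (i) isomorphism EXISTS and is UNIQUE (abc-iut-L6-t5's unconditional `GoodPrimeKummer.prop42i_of_monoAnalytic`,
label by label). [claim: Mochizuki2012, status: disputed] -/
theorem prop21iv_labeled_existsUnique (hP : ∀ t, IsOfMonoAnalyticTypeMonoid .TM (P t))
    (hQ : ∀ t, IsOfMonoAnalyticTypeMonoid .TM (Q t)) :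
    ∃! Φ : ∀ t, (P t).M ≃* (Q t).M, ∀ t, Φ t ∈ equivariantIsoOver (P t) (Q t) (f t) := by
  have h := fun t => prop42i_of_monoAnalytic (hP t) (hQ t) (f t)
  refine ⟨fun t => (h t).exists.choose, fun t => (h t).exists.choose_spec, fun Φ hΦ => funext fun t => ?_⟩
  exact equivariantIsoOver_subsingleton (isMLFGaloisMonoidPair_of_isOfMonoAnalyticTypeMonoid (hP t))
    (isMLFGaloisMonoidPair_of_isOfMonoAnalyticTypeMonoid (hQ t)) (f t) (hΦ t) (h t).exists.choose_spec

/-- **IUTchIII:Prop2.1(iv)** (kurims p.60) "is obtained as": ANY labelled family `κ` of `f t`-equivariant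
isomorphisms `(Ψ_{F_env}(†HT^Θ))_{v,t} ⥲ (Ψ_env(†D_>))_{v,t}` — the `(v, t)`-components of a Kummer isomorphism of Prop
2.1 (ii) at a good nonarchimedean `v` — coincides with any other such family, hence with the labelled Prop 4.2
(i) isomorphism (MLF-Galois `TM`-pairs suffice: [AbsTopIII] Prop 3.2 (iv) injectivity, PROVED as
`pairIsoDeterminedByGalois_holds`; cf. w4-d022's `labeled_pairIso_isoM_eq_of_isoPi_eq`).
[claim: Mochizuki2012, status: disputed] -/
theorem prop21iv_kummer_eq (hP' : ∀ t, IsMLFGaloisMonoidPair .TM (P t)) (hQ' : ∀ t, IsMLFGaloisMonoidPair .TM (Q t))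
    (κ Φ : ∀ t, (P t).M ≃* (Q t).M) (hκ : ∀ t, κ t ∈ equivariantIsoOver (P t) (Q t) (f t))
    (hΦ : ∀ t, Φ t ∈ equivariantIsoOver (P t) (Q t) (f t)) : κ = Φ :=
  funext fun t => equivariantIsoOver_subsingleton (hP' t) (hQ' t) (f t) (hκ t) (hΦ t)

/-- **IUTchIII:Prop2.1(iv)** (kurims p.60) labelled copies are LITERAL copies (abc-iut-L6-t2's convention for
`(Ψ_{†F_v})_t`, [IUTchII] Prop 4.2 (iii)): for constant families `t ↦ P₀`, `t ↦ Q₀`, `t ↦ f₀` every labelled family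
of `f₀`-equivariant isomorphisms, read as ONE isomorphism of the product monoids `∏_t (Ψ_{†F_v})_t ⥲ ∏_t Ψ_cns(†Π_v)_t`,
IS abc-iut-L6-t5's `GoodPrimeKummer.labeledIso Lab φ₀` for the Prop 4.2 (i) isomorphism `φ₀`
(GoodPrimeKummerBridgeTheta.lean). [claim: Mochizuki2012, status: disputed] -/
theorem prop21iv_piCongrRight_eq_labeledIso {P₀ Q₀ : GaloisMonoidPair.{0}} (f₀ : P₀.Pi ≃ₜ* Q₀.Pi)
    (hP₀ : IsMLFGaloisMonoidPair .TM P₀) (hQ₀ : IsMLFGaloisMonoidPair .TM Q₀) {φ₀ : P₀.M ≃* Q₀.M}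
    (hφ₀ : φ₀ ∈ equivariantIsoOver P₀ Q₀ f₀) (κ : Lab → (P₀.M ≃* Q₀.M))
    (hκ : ∀ t, κ t ∈ equivariantIsoOver P₀ Q₀ f₀) :
    MulEquiv.piCongrRight κ = labeledIso Lab φ₀ := by
  have : κ = fun _ => φ₀ := funext fun t => equivariantIsoOver_subsingleton hP₀ hQ₀ f₀ (hκ t) hφ₀
  subst this
  rfl

/-! ### 2. (iv): the unit portion -/

/-- **IUTchIII:Prop2.1(iv)** (kurims p.60) the unit pair `(G_v ↷ Ψ^×)` of a `TM`-pair `(G_v ↷ Ψ)` OF MONO-ANALYTIC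
TYPE is a `TCG`-pair of mono-analytic type ([AbsTopIII] Def 3.1 (ii)(iii): the same model `(Π_k ↷ 𝒪^⊳_k̄)` with
bijective open `Π_k ↠ G_k` has unit pair the model `TCG`-pair, abc-iut-L4-t2's `ModelMLFGaloisData.unitsIsoTCG`;
mono-analytic companion of `GaloisMonoidPair.isMLFGaloisMonoidPair_TCG_unitsPair`) — so that [IUTchII] Prop 4.2
(ii)'s `Ẑ^×`-torsor statement applies to the unit portions. [claim: Mochizuki2012, status: disputed] -/
theorem isOfMonoAnalyticTypeMonoid_TCG_unitsPair {P₀ : GaloisMonoidPair.{u}}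
    (hP₀ : IsOfMonoAnalyticTypeMonoid .TM P₀) : IsOfMonoAnalyticTypeMonoid .TCG P₀.unitsPair := by
  obtain ⟨C, D, Q₀, hbij, hQ₀, ⟨e⟩⟩ := hP₀.exists_model
  have hQ₀' : D.tmPair = Q₀ := Option.some_injective _ (D.monoidPair_TM.symm.trans hQ₀)
  subst hQ₀'
  exact ⟨⟨C, D, D.tcgPair, hbij, D.monoidPair_TCG,
    ⟨(ModelMLFGaloisData.unitsIsoTCG C D).symm.trans e.units⟩⟩⟩

/-- **IUTchIII:Prop2.1(iv)** (kurims p.60) [IUTchII] Prop 4.2 (ii)'s "unique `†G_v`-equivariant `Ẑ^×`-orbit of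
isomorphisms of topological groups `Ψ^×_{†F^⊢_v} ⥲ Ψ_cns(†G_v)^×`" HOLDS, label by label, for the unit pairs of the
labelled `TM`-pairs of (iv) (abc-iut-L6-t5's `Prop42iiUnit` via the unconditional `prop42iiUnit_of_monoAnalytic`).
[claim: Mochizuki2012, status: disputed] -/
theorem prop21iv_prop42iiUnit (hP : ∀ t, IsOfMonoAnalyticTypeMonoid .TM (P t))
    (hQ : ∀ t, IsOfMonoAnalyticTypeMonoid .TM (Q t)) (t : Lab) : Prop42iiUnit (P t).unitsPair (Q t).unitsPair (f t) :=
  prop42iiUnit_of_monoAnalytic (isOfMonoAnalyticTypeMonoid_TCG_unitsPair (hP t))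
    (isOfMonoAnalyticTypeMonoid_TCG_unitsPair (hQ t)) (f t)

/-- **IUTchIII:Prop2.1(iv)** (kurims p.60) "The unit portion at `v ∈ V^good ∩ V^non` of the Kummer isomorphisms
of (ii) is obtained … as the unit portion of a “labeled version” of the isomorphism … of “MLF-Galois TM-pairs” …
[IUTchII], Proposition 4.2, (i)": for a labelled family `κ` of `f t`-equivariant Kummer isomorphisms, the unit
portion `(κ t)^× = Units.mapEquiv (κ t)` is `f t`-equivariant on the unit pairs and is THE UNIQUE member of [IUTchII]
Prop 4.2 (ii)'s `Ẑ^×`-torsor with its cyclotome datum: every `f t`-equivariant isomorphism of the unit groups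
inducing the same isomorphism of cyclotomes IS `(κ t)^×` (abc-iut-L6-t5's `equivariantIsoOver_eq_of_cyclotome_eq`,
[AbsTopIII] Prop 3.3 (ii) determination half PROVED). [claim: Mochizuki2012, status: disputed] -/
theorem prop21iv_unitPortion (hP : ∀ t, IsOfMonoAnalyticTypeMonoid .TM (P t))
    (hQ : ∀ t, IsOfMonoAnalyticTypeMonoid .TM (Q t))
    (κ : ∀ t, (P t).M ≃* (Q t).M)
    (hκ : ∀ t, κ t ∈ equivariantIsoOver (P t) (Q t) (f t)) (t : Lab) :
    Units.mapEquiv (κ t) ∈ equivariantIsoOver (P t).unitsPair (Q t).unitsPair (f t) ∧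
      ∀ ψ : (P t).Mˣ ≃* (Q t).Mˣ, ψ ∈ equivariantIsoOver (P t).unitsPair (Q t).unitsPair (f t) →
        (∀ ζ, cyclotomeMapOf (P := (P t).unitsPair) (Q := (Q t).unitsPair) ψ ζ =
          cyclotomeMapOf (P := (P t).unitsPair) (Q := (Q t).unitsPair) (Units.mapEquiv (κ t)) ζ) →
        ψ = Units.mapEquiv (κ t) := by
  refine ⟨unitsMapEquiv_mem_equivariantIsoOver (hκ t), fun ψ hψ hζ => ?_⟩
  exact equivariantIsoOver_eq_of_cyclotome_eq
    (GaloisMonoidPair.isMLFGaloisMonoidPair_TCG_unitsPair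
      (isMLFGaloisMonoidPair_of_isOfMonoAnalyticTypeMonoid (hP t)))
    (GaloisMonoidPair.isMLFGaloisMonoidPair_TCG_unitsPair
      (isMLFGaloisMonoidPair_of_isOfMonoAnalyticTypeMonoid (hQ t)))
    (f t) hψ (unitsMapEquiv_mem_equivariantIsoOver (hκ t)) hζ

/-- **IUTchIII:Prop2.1(iv)** (kurims p.60) "[cf. [IUTchII], Proposition 4.2, (iv)]": on the theta monoids, the
Kummer isomorphism `Ψ_{†F^Θ_v} ⥲ Ψ_env(†Π_v)` that abc-iut-L6-t5 builds from the unit portion `(κ t)^×`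
(`GoodPrimeKummer.thetaKummerIso`, Frobenioid-side datum `frobeniusSide`) restricts on the unit copies to
`(κ t)^×` and to the identity on the splitting ray — its unit portion IS the unit portion of the labelled Prop 4.2
(i) isomorphism. [claim: Mochizuki2012, status: disputed] -/
theorem prop21iv_thetaKummerIso_unit (Ψ : ConstantMonoidDatum.{0}) (t : Lab) (κ : (P t).M ≃* (Q t).M)
    (e : (Q t).Mˣ ≃* Ψ.Units) (u : (P t).Mˣ) (c : Multiplicative ℝ≥0) :
    thetaKummerIso Ψ (CommGrpCat.of (P t).Mˣ) ((Units.mapEquiv κ).trans e) (u, 1) =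
        (((Units.mapEquiv κ).trans e) u, 1) ∧
      thetaKummerIso Ψ (CommGrpCat.of (P t).Mˣ) ((Units.mapEquiv κ).trans e) (1, c) = (1, c) :=
  ⟨thetaKummerIso_unit Ψ (CommGrpCat.of (P t).Mˣ) ((Units.mapEquiv κ).trans e) u,
    thetaKummerIso_ray Ψ (CommGrpCat.of (P t).Mˣ) ((Units.mapEquiv κ).trans e) c⟩

/-! ### 3. (iv), "In particular": the `Aut`-orbit is the Kummer poly-isomorphism of semi-simplifications -/

/-- **IUTchIII:Prop2.1(iv)** (kurims p.60) "the portion at `v ∈ V^good ∩ V^non` of the `Aut_{F^⊩}(†F^⊩_env)`-orbit of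
the second isomorphism of the final display of (ii) may be obtained as a “labeled version” of the “Kummer
poly-isomorphism of semi-simplifications” given in the final display of [IUTchII], Proposition 4.2, (ii)": at the
label `t`, with `φ^× := (κ t)^×` the unit portion of the Kummer isomorphism and `φ^× × ρ₀ : Ψ^ss_{†F^⊢_v} =
Ψ^× × Ψ^R ⥲ Ψ_cns(†G_v)^× × R_{≥0}(†G_v)` abc-iut-L6-t5's member `semiSimplifiedIsoNonarch` (`ρ₀` THE normalised realified
isomorphism), the ORBIT of `φ^× × ρ₀` under pre-composition with the automorphisms `α × id` of `Ψ^ss_{†F^⊢_v}` — `α`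
ranging over the `†G_v`-equivariant automorphisms of the unit pair `(†G_v ↷ Ψ^×_{†F^⊢_v})` (the unit-portion action of
`Aut_{F^⊩}`; the realified portion is rigid, `PointedHalfLine.addEquiv_eq_refl_of_apply_pt`) — is EXACTLY the
Kummer poly-isomorphism of semi-simplifications `GoodPrimeKummer.semiSimplifiedPolyIsoNonarch` of [IUTchII] Prop 4.2
(ii). [claim: Mochizuki2012, status: disputed] -/
theorem prop21iv_autOrbit_eq_semiSimplifiedPolyIso (t : Lab) (κ : (P t).M ≃* (Q t).M)
    (hκ : κ ∈ equivariantIsoOver (P t) (Q t) (f t)) (h : IsMonoprime (Associates (P t).M)) {p : (P t).M}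
    (hp : ¬ IsUnit p) (D : LogRealDatum) :
    {e | ∃ α : (P t).Mˣ ≃* (P t).Mˣ,
        α ∈ equivariantIsoOver (P t).unitsPair (P t).unitsPair (ContinuousMulEquiv.refl _) ∧
          e = (MulEquiv.prodCongr α (MulEquiv.refl (PsiRlf (P t).M))).trans
            (semiSimplifiedIsoNonarch (P t) (Q t) h hp D (Units.mapEquiv κ))} =
      semiSimplifiedPolyIsoNonarch (P t) (Q t) (f t) (p := p) D := by
  have hκu := unitsMapEquiv_mem_equivariantIsoOver hκ
  ext e
  rw [mem_semiSimplifiedPolyIsoNonarch_iff (P t) (Q t) (f t) h hp D]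
  constructor
  · rintro ⟨α, hα, rfl⟩
    refine ⟨α.trans (Units.mapEquiv κ), fun g m => ?_, MulEquiv.ext fun x => rfl⟩
    exact (congrArg (Units.mapEquiv κ) (hα g m)).trans (hκu _ (α m))
  · rintro ⟨φ, hφ, rfl⟩
    refine ⟨φ.trans (Units.mapEquiv κ).symm, fun g m => ?_, MulEquiv.ext fun x => ?_⟩
    · -- test after `φ^×`: both sides map to `(f t) g • φ m`
      apply (Units.mapEquiv κ).injective
      exact (((Units.mapEquiv κ).apply_symm_apply _).trans (hφ g m)).trans
        ((hκu _ _).trans (congrArg _ ((Units.mapEquiv κ).apply_symm_apply (φ m)))).symm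
    · change (φ x.1, PsiRlf.toNNReal h hp D x.2) =
        (Units.mapEquiv κ ((Units.mapEquiv κ).symm (φ x.1)), PsiRlf.toNNReal h hp D x.2)
      rw [MulEquiv.apply_symm_apply]

/-- **IUTchIII:Prop2.1(iv)** (kurims p.60) … and that labelled poly-isomorphism is, label by label, EXACTLY ONE
`Ẑ^×`-torsor (F9's `existsUnique_mem_semiSimplifiedPolyIsoNonarch`, here unconditional because the unit pairs are
`TCG`-pairs of mono-analytic type). [claim: Mochizuki2012, status: disputed] -/
theorem prop21iv_semiSimplifiedPolyIso_torsor (hP : ∀ t, IsOfMonoAnalyticTypeMonoid .TM (P t))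
    (hQ : ∀ t, IsOfMonoAnalyticTypeMonoid .TM (Q t)) (t : Lab) (h : IsMonoprime (Associates (P t).M)) {p : (P t).M}
    (hp : ¬ IsUnit p) (D : LogRealDatum)
    (uζ : cyclotome (P t).unitsPair.M ≃* cyclotome (Q t).unitsPair.M) :
    ∃! e : SemiSimplifiedRlf (P t).M ≃* (Q t).Mˣ × Multiplicative ℝ≥0,
      ∃ φ : (P t).Mˣ ≃* (Q t).Mˣ, φ ∈ equivariantIsoOver (P t).unitsPair (Q t).unitsPair (f t) ∧
        (∀ ζ, cyclotomeMapOf (P := (P t).unitsPair) (Q := (Q t).unitsPair) φ ζ = uζ ζ) ∧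
        e = semiSimplifiedIsoNonarch (P t) (Q t) h hp D φ :=
  existsUnique_mem_semiSimplifiedPolyIsoNonarch (P t) (Q t) (f t) h hp D
    (isOfMonoAnalyticTypeMonoid_TCG_unitsPair (hP t)) (isOfMonoAnalyticTypeMonoid_TCG_unitsPair (hQ t)) uζ

end GoodNonarch

/-! ### 4. (v) at `v ∈ V^arc`: the labelled isomorphism of topological monoids of [IUTchII] Prop 4.4 (i) -/

section Arch

variable {Kv : Type u} [NormedField Kv] [NormedAlgebra ℝ Kv] (X : ArchLocalFrobenioid.{u} Kv) {Lab : Type w}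

/-- **IUTchIII:Prop2.1(v)** (kurims p.60) "a “labeled version” of the isomorphism of topological monoids discussed
in [IUTchII], Proposition 4.4, (i)": every labelled family `κ : t ↦ ((Ψ_{†F_v})_t ⥲ Ψ_cns(†U_v)_t)` of isomorphisms
through which the Kummer structure `†κ_v` factors — the `(v, t)`-components of a Kummer isomorphism of Prop 2.1
(ii) at `v ∈ V^arc` — is the CONSTANT family of abc-iut-L6-t5's `kummerIsoArch X` (Prop 4.4 (i) uniqueness,
`eq_kummerIsoArch`; existence `Prop44i_holds`). [claim: Mochizuki2012, status: disputed] -/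
theorem prop21v_labeled_eq_const (κ : Lab → (X.OC ≃* unitDiscMonoid X.Afield))
    (hκ : ∀ t (m : X.OC), (κ t m : X.Afield) = X.kappa m) : κ = fun _ => kummerIsoArch X :=
  funext fun t => eq_kummerIsoArch X (hκ t)

/-- **IUTchIII:Prop2.1(v)** (kurims p.60) the labelled family read as ONE isomorphism of product monoids is F9's
`archLabeledIso X Lab` ([IUTchII] Prop 4.4 (iii), GoodPrimeKummerBridgeArchUnits.lean).
[claim: Mochizuki2012, status: disputed] -/
theorem prop21v_piCongrRight_eq_archLabeledIso (κ : Lab → (X.OC ≃* unitDiscMonoid X.Afield))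
    (hκ : ∀ t (m : X.OC), (κ t m : X.Afield) = X.kappa m) :
    MulEquiv.piCongrRight κ = archLabeledIso X Lab := by
  rw [prop21v_labeled_eq_const X κ hκ]
  rfl

/-- **IUTchIII:Prop2.1(v)** (kurims p.60) "The unit portion at `v ∈ V^arc` of the Kummer isomorphisms of (ii) is
obtained [cf. [IUTchII], Proposition 4.4, (iv)] as the unit portion of a “labeled version” of the isomorphism of
topological monoids discussed in [IUTchII], Proposition 4.4, (i)": at each label the unit portion of `κ t` IS
`φ^× = unitKummerTopIso X` (F9, as an isomorphism of groups), which lies in the unique `{±1}`-orbit of [IUTchII] Prop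
4.4 (ii) (`Prop44iiUnit_holds`; every isomorphism of topological groups `Ψ^×_{†F^⊢_v} ⥲ Ψ_cns(†D^⊢_v)^×` is `φ^×` or
`φ^× ∘ (−)⁻¹`, `unitKummerTopIso_orbit`). [claim: Mochizuki2012, status: disputed] -/
theorem prop21v_unitPortion (κ : Lab → (X.OC ≃* unitDiscMonoid X.Afield))
    (hκ : ∀ t (m : X.OC), (κ t m : X.Afield) = X.kappa m) (t : Lab) :
    Units.mapEquiv (κ t) = (unitKummerTopIso X).toMulEquiv ∧ Prop44iiUnit X ∧
      ∀ ψ : X.OCˣ ≃ₜ* (unitDiscMonoid X.Afield)ˣ,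
        ψ = unitKummerTopIso X ∨ ψ = (unitKummerTopIso X).trans (invEquiv _) := by
  refine ⟨?_, Prop44iiUnit_holds X, unitKummerTopIso_orbit X⟩
  rw [eq_kummerIsoArch X (hκ t)]
  exact MulEquiv.ext fun u => (unitKummerTopIso_apply X u).symm

/-- **IUTchIII:Prop2.1(v)** (kurims p.60) "the portion at `v ∈ V^arc` of the `Aut_{F^⊩}(†F^⊩_env)`-orbit of the second
isomorphism of the final display of (ii) may be obtained as a “labeled version” of the “Kummer poly-isomorphism
of semi-simplifications” given in the final display of [IUTchII], Proposition 4.4, (ii)": the ORBIT of F9's member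
`φ^× × ρ : Ψ^ss_{†F^⊢_v} = Ψ^× × Ψ^R ⥲ Ψ^ss_cns(†D^⊢_v)` (`semiSimplifiedIsoArch X`) under pre-composition with `ε × id`, `ε`
ranging over ALL automorphisms of the topological group `Ψ^×_{†F^⊢_v}` (the unit-portion action of `Aut_{F^⊩}`; the
realified portion is rigid), is EXACTLY the poly-isomorphism `GoodPrimeKummer.semiSimplifiedPolyIso X` of [IUTchII]
Prop 4.4 (ii) — whose members are `φ^× × ρ` and `(φ^× ∘ (−)⁻¹) × ρ` (`mem_semiSimplifiedPolyIso_iff`).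
[claim: Mochizuki2012, status: disputed] -/
theorem prop21v_autOrbit_eq_semiSimplifiedPolyIso :
    {e | ∃ ε : X.OCˣ ≃ₜ* X.OCˣ,
        e = (MulEquiv.prodCongr ε.toMulEquiv (MulEquiv.refl (Associates X.OC))).trans
          (semiSimplifiedIsoArch X)} = semiSimplifiedPolyIso X := by
  ext e
  rw [mem_semiSimplifiedPolyIso_iff]
  constructor
  · rintro ⟨ε, rfl⟩
    rcases unitKummerTopIso_orbit X (ε.trans (unitKummerTopIso X)) with h | h
    · left
      refine MulEquiv.ext fun x => Prod.ext ?_ rfl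
      exact DFunLike.congr_fun h x.1
    · right
      refine MulEquiv.ext fun x => Prod.ext ?_ rfl
      exact DFunLike.congr_fun h x.1
  · rintro (rfl | rfl)
    · exact ⟨ContinuousMulEquiv.refl _, MulEquiv.ext fun x => rfl⟩
    · refine ⟨invEquiv _, MulEquiv.ext fun x => Prod.ext ?_ rfl⟩
      change (unitKummerTopIso X x.1)⁻¹ = unitKummerTopIso X x.1⁻¹
      rw [map_inv]

end Arch

end Literature.IUT.LogThetaLattice

end
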